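import Literature.IUT.HodgeTheaters.TemperedCoveringsCor23iiiOfSpecialFibre
import Literature.IUT.HodgeTheaters.CommensuratorLemmas
import HarnessLib

/-!
# [IUTchI] Cor. 2.3 (i), (v): the typed predicates are EQUIVALENT to 𝔾-level statements — exact residuals
# of the rows `IUTchI:Cor2.3(i)`, `IUTchI:Cor2.3(v)` at the genuine 𝔛-datum

Mochizuki, *Inter-universal Teichmüller theory I: construction of Hodge theaters*, kurims manuscript
(May 2020), §2, Corollary 2.3 (i) p. 47 l. 31–35, (iv) p. 47 l. 44–46, (v) p. 48 l. 1–2; proofs p. 48 l. 13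
("Assertion (i) follows immediately from Proposition 2.2"), p. 49 l. 33–34 ("assertion (iv) follows immediately
from assertion (i)"), p. 49 l. 38 – p. 50 l. 2 ("it suffices to verify that … `F̂ ⋂ G = F`")
[cite: Mochizuki2012, Cor 2.3 pp.47-50] (D-0012 claim key; series status DISPUTED; nothing of the series is
asserted here), over Mochizuki, *Semi-graphs of anabelioids*, Publ. RIMS **42** (2006), Ex. 3.10 pp. 43–45
[cite: MochizukiSemiAnbd2006, Ex 3.10 pp.43-45].

PROOF-ONLY companion (abc-iut cell, R-C discharge re-arm W9 (i), seat abc-iut-w5-d028 — holder of record of the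
index rows `IUTchI:Cor2.3(i)`, `(iv)`, `(v)`, `IUTchI:Cor2.5` of `plan/L5/SUBDAG-IUTchI-Cor23.md`).  No definition,
no new `Prop` fact, no statement file edited.  Companion of `TemperedCoveringsCor23OfSpecialFibreCommTerminal`
(same seat: the §2 certificate route (α) with its law `h22` weakened).

* **A. Group theory.** `commensurator_eq_of_comap_surjective`: commensurable terminality DESCENDS along a
  surjection `f : A ↠ B` (`C_A(f⁻¹S) = f⁻¹S ⇒ C_B(S) = S`), the converse of abc-iut-L5-t11's
  `IsCommensurablyTerminal.comap_of_surjective` (`CommensuratorLemmas`) — `commensurator_comap_eq_iff_of_surjective`.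
* **B. Abstract 𝔛-data** (`D : StableCurveTemperedData`, any inhabitant).  `cor23i_iff_graph`: Cor. 2.3 (i) AS
  TYPED is EQUIVALENT to the two 𝔾-level clauses `C_{Π^tp_𝔾}(Π^tp_ℍ) = Π^tp_ℍ` and `C_{Π̂_𝔾}(Π̂_ℍ) = Π̂_ℍ` of
  Prop. 2.2 (`CommensuratorsOfDecompositionSubgroups.tpH_in_tp`, `.hatH`); the other two printed clauses
  (`tpH_in_hat`: `Π^tp_ℍ` c.t. in `Π̂_𝔾`; `tp_in_hat`: "in particular `Π^tp_𝔾` is c.t. in `Π̂_𝔾`") are NOT consumed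
  by Cor. 2.3 (i)–(iv) (the assembly chain of record enters Prop. 2.2 only through abc-iut-L5-t11's
  `cor23i_of_prop22`).  `cor23v_iff_graph` / `cor23v_iff_comap`: Cor. 2.3 (v) AS TYPED is EQUIVALENT to the
  𝔾-level identity `Π̂_ℍ ∩ Π^tp_𝔾 = Π^tp_ℍ` inside `Π̂_𝔾` (the hypothesis `hv` of abc-iut-L5-d4's `cor23v_of_graph`;
  print: "it follows immediately from the definitions … that it suffices to verify … `F̂ ⋂ G = F`", p. 49) — so the
  layer-5 certificate's law `hv` (`Summits/ABC/IUTFork/Conditional/Layer5OfSV06.lean`, route (α)) is EXACTLY the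
  node, nothing assumed away, and its law `h22` is consumed only through two of its four clauses.
* **C. Genuine datum** `𝔇 := StableCurveTemperedData.ofSpecialFibre X d S h36 …` (abc-iut-L5-t11), parameters
  `Π^tp_ℍ := TpH`, `Π̂_ℍ := HatH`, resp. print's `Π̂_ℍ :=` the closure of `ι(Π^tp_ℍ)` in `Π̂_𝔾`:
  `cor23i_ofSpecialFibre_iff` / `cor23i_ofSpecialFibre_closureH_iff` (row Cor2.3(i) ⇔ `TpH` c.t. in `π₁^temp(G^c)`
  and `Π̂_ℍ` c.t. in `Π̂_𝔾`), `cor23i_ofSpecialFibre_of_commTerminal` (row Cor2.3(i) BY NAME from these two binders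
  ONLY — no tower, no `hHstab`, no KER-LEVEL), `cor23v_ofSpecialFibre_iff` / `cor23v_ofSpecialFibre_closureH_iff`
  (row Cor2.3(v) ⇔ `ι⁻¹(Π̂_ℍ) = TpH`, i.e. at print's parameter "`Π^tp_ℍ` is closed for the profinite topology of
  `π₁^temp(G^c)`"), `cor23v_ofSpecialFibre_closureH_of_closed` (row Cor2.3(v) BY NAME from that one binder).

HONEST RESIDUAL (numbers, not adjectives).  With `Π^tp_ℍ` a bare PARAMETER `TpH ≤ π₁^temp(G^c)` of the bridge,
rows (i)/(iv)/(v) cannot close unconditionally: (i) ⇔ {`htp`, `hhat`}, (v) ⇔ profinite-closedness of `TpH`, and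
both FAIL for some parameters (e.g. `TpH = ⊥` in a nontrivial `π₁^temp(G^c)` for (i)); they become theorems
exactly when `TpH` is the decomposition group of a connected sub-semi-graph `ℍ` — an L3 CONSTRUCTION
(`Π^tp_{𝔾,ℍ} ≤ π₁^temp(𝒢)` through the chart's `B^temp`-equivalence) that the tree does not yet have; the exact
statements such a construction must deliver for these rows are `htp`, `hhat` (the latter = GAP-LEDGER G-w5d028-1,
[SemiAnbd] Cor. 2.7 (i) pro-`Σ̂`), the profinite-closedness of (v) (print's free-factor/M. Hall step, kernel-proved
abstractly as `ProfiniteCompletion.range_inter_closure_image_of_retract` by abc-iut-L5-d4), `hHstab`, and the cusp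
incidences of (vi).  Model-RELATIVE (∀ `X`, `d`, `S`, parameters); typed ≠ discharged; a binder is an assumption
label; nothing here bears on [IUTchIII] Cor. 3.12 or asserts that abc is proved or refuted.
-/

noncomputable section

namespace Literature.IUT.HodgeTheaters

open _root_.Topology
open scoped Pointwise
open Literature.AnabelianGeometry.SemiGraphs
open Literature.AnabelianGeometry.AbsoluteAnabelian (IsCommensurablyTerminal)
open Literature.AlgebraicGeometry.Frobenioids (IsSlimGroup)
open Literature.IUT.HodgeTheaters.IsCommensurablyTerminal (comap_of_surjective)

/-! ### A. Commensurable terminality descends along surjections -/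

section GroupTheory

variable {A : Type*} [Group A] {B : Type*} [Group B]

/-- Preimage of a conjugate: `f⁻¹(f(a) S f(a)⁻¹) = a f⁻¹(S) a⁻¹` for ANY homomorphism `f` (`ConjAct` form).
[cite: Mochizuki2012, Cor 2.3(i) p.48] -/
theorem comap_conjAct_smul_eq (f : A →* B) (a : A) (S : Subgroup B) :
    (ConjAct.toConjAct (f a) • S).comap f = ConjAct.toConjAct a • S.comap f := by
  ext x
  rw [Subgroup.mem_comap, Subgroup.mem_pointwise_smul_iff_inv_smul_mem,
    Subgroup.mem_pointwise_smul_iff_inv_smul_mem, Subgroup.mem_comap, ← ConjAct.toConjAct_inv,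
    ← ConjAct.toConjAct_inv, ConjAct.toConjAct_smul, ConjAct.toConjAct_smul]
  simp only [map_mul, map_inv, inv_inv]

/-- **Commensurable terminality DESCENDS along surjections**: if `f : A ↠ B` is surjective and `f⁻¹(S) ⊆ A`
is commensurably terminal, so is `S ⊆ B` — the converse of `IsCommensurablyTerminal.comap_of_surjective`
("Assertion (i) follows immediately from Proposition 2.2", p. 48, read backwards along `Δ^tp_X ↠ Π^tp_𝔾`,
`Δ̂_X ↠ Π̂_𝔾`). [cite: Mochizuki2012, Cor 2.3(i) p.48] -/
theorem commensurator_eq_of_comap_surjective (f : A →* B) (hf : Function.Surjective f)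
    {S : Subgroup B} (h : Subgroup.Commensurable.commensurator (S.comap f) = S.comap f) :
    Subgroup.Commensurable.commensurator S = S := by
  refine isCommensurablyTerminal_of_le fun b hb => ?_
  obtain ⟨a, rfl⟩ := hf b
  rw [Subgroup.Commensurable.commensurator_mem_iff] at hb
  have ha : a ∈ Subgroup.Commensurable.commensurator (S.comap f) := by
    rw [Subgroup.Commensurable.commensurator_mem_iff, ← comap_conjAct_smul_eq f a S]
    refine ⟨?_, ?_⟩
    · rw [Subgroup.relIndex_comap, Subgroup.map_comap_eq_self_of_surjective hf]
      exact hb.1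
    · rw [Subgroup.relIndex_comap, Subgroup.map_comap_eq_self_of_surjective hf]
      exact hb.2
  rw [h, Subgroup.mem_comap] at ha
  exact ha

/-- `C_A(f⁻¹S) = f⁻¹S ⇔ C_B(S) = S` along a surjection `f : A ↠ B`. [cite: Mochizuki2012, Cor 2.3(i) p.48] -/
theorem commensurator_comap_eq_iff_of_surjective (f : A →* B) (hf : Function.Surjective f)
    (S : Subgroup B) :
    Subgroup.Commensurable.commensurator (S.comap f) = S.comap f ↔
      Subgroup.Commensurable.commensurator S = S :=
  ⟨commensurator_eq_of_comap_surjective f hf, comap_of_surjective f hf⟩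

end GroupTheory

/-! ### B. Abstract 𝔛-data: Cor. 2.3 (i) and (v) are EQUIVALENT to 𝔾-level statements -/

namespace StableCurveTemperedData

universe u

section Abstract

variable (D : StableCurveTemperedData.{u})

/-- **Cor. 2.3 (i) AS TYPED ⇔ the two consumed clauses of Prop. 2.2**: `Δ^tp_{X,ℍ} = ρ⁻¹(Π^tp_ℍ)` is c.t. in
`Δ^tp_X` iff `Π^tp_ℍ` is c.t. in `Π^tp_𝔾`, and `Δ̂_{X,ℍ} = ρ̂⁻¹(Π̂_ℍ)` is c.t. in `Δ̂_X` iff `Π̂_ℍ` is c.t. in `Π̂_𝔾`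
(surjectivity of `Δ^tp_X ↠ Π^tp_𝔾`, `Δ̂_X ↠ Π̂_𝔾`, p. 47).  `⇐` is abc-iut-L5-t11's `cor23i_of_prop22`.
[cite: Mochizuki2012, Cor 2.3(i) pp.47-48] -/
theorem cor23i_iff_graph :
    D.Cor23i ↔ IsCommensurablyTerminal D.graph.TpH ∧ IsCommensurablyTerminal D.graph.HatH := by
  constructor
  · intro h
    exact ⟨⟨commensurator_eq_of_comap_surjective D.ρTp D.ρTp_surjective h.tp.commensurator_eq⟩,
      ⟨commensurator_eq_of_comap_surjective D.ρHat D.ρHat_surjective h.hat.commensurator_eq⟩⟩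
  · rintro ⟨htp, hhat⟩
    exact ⟨⟨comap_of_surjective D.ρTp D.ρTp_surjective htp.commensurator_eq⟩,
      ⟨comap_of_surjective D.ρHat D.ρHat_surjective hhat.commensurator_eq⟩⟩

/-- **Cor. 2.3 (i) from the two consumed clauses of Prop. 2.2 only** (`C_{Π^tp_𝔾}(Π^tp_ℍ) = Π^tp_ℍ`,
`C_{Π̂_𝔾}(Π̂_ℍ) = Π̂_ℍ`); the clauses `tpH_in_hat`, `tp_in_hat` of `CommensuratorsOfDecompositionSubgroups` are not
needed. [cite: Mochizuki2012, Cor 2.3(i) p.48] -/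
theorem cor23i_of_commTerminal (htp : IsCommensurablyTerminal D.graph.TpH)
    (hhat : IsCommensurablyTerminal D.graph.HatH) : D.Cor23i :=
  D.cor23i_iff_graph.2 ⟨htp, hhat⟩

/-- Prop. 2.2 AS TYPED implies the two clauses consumed by Cor. 2.3 (the converse fails in general: the clause
"`Π^tp_𝔾` c.t. in `Π̂_𝔾`" does not follow). [cite: Mochizuki2012, Prop 2.2 p.45] -/
theorem commTerminal_of_prop22 (h22 : D.graph.CommensuratorsOfDecompositionSubgroups) :
    IsCommensurablyTerminal D.graph.TpH ∧ IsCommensurablyTerminal D.graph.HatH :=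
  ⟨h22.tpH_in_tp, h22.hatH⟩

/-- **Cor. 2.3 (v) AS TYPED ⇔ the 𝔾-level identity `Π̂_ℍ ∩ Π^tp_𝔾 = Π^tp_ℍ` inside `Π̂_𝔾`** (set form; the
hypothesis `hv` of `cor23v_of_graph`).  `⇒`: for `t = ρ(δ) ∈ Π^tp_𝔾` with `ι(t) ∈ Π̂_ℍ`, `ι_Δ(δ) ∈ Δ̂_{X,ℍ} ∩ Δ^tp_X
= Δ^tp_{X,ℍ}`, so `t ∈ Π^tp_ℍ` (injectivity of `ι_Δ`, surjectivity of `ρ`). [cite: Mochizuki2012, Cor 2.3(v) pp.48-50] -/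
theorem cor23v_iff_graph :
    D.Cor23v ↔ (D.graph.HatH : Set D.graph.Hat) ∩ Set.range D.graph.ι = D.graph.ι '' D.graph.TpH := by
  refine ⟨fun h => Set.Subset.antisymm ?_ ?_, D.cor23v_of_graph⟩
  · rintro _ ⟨hyH, ⟨t, rfl⟩⟩
    obtain ⟨δ, rfl⟩ := D.ρTp_surjective t
    have hmem : D.ιΔ δ ∈ D.deltaHatH ⊓ D.ιΔ.range := by
      refine ⟨?_, ⟨δ, rfl⟩⟩
      show D.ρHat (D.ιΔ δ) ∈ D.graph.HatH
      rw [D.ρHat_ιΔ]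
      exact hyH
    rw [h.inf_eq] at hmem
    obtain ⟨δ', hδ', hδδ⟩ := hmem
    refine ⟨D.ρTp δ, ?_, rfl⟩
    show D.ρTp δ ∈ D.graph.TpH
    rw [← D.ιΔ_injective hδδ]
    exact hδ'
  · rintro _ ⟨t, ht, rfl⟩
    exact ⟨D.graph.tpH_le ⟨t, ht, rfl⟩, ⟨t, rfl⟩⟩

/-- **Cor. 2.3 (v) AS TYPED ⇔ `ι⁻¹(Π̂_ℍ) = Π^tp_ℍ`** (subgroup form of the previous: `Π^tp_ℍ` is the full preimage
of `Π̂_ℍ` in `Π^tp_𝔾` — for print's `Π̂_ℍ :=` closure of `Π^tp_ℍ`, "`Π^tp_ℍ` is closed for the profinite topology").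
[cite: Mochizuki2012, Cor 2.3(v) pp.48-50] -/
theorem cor23v_iff_comap : D.Cor23v ↔ D.graph.HatH.comap D.graph.ι = D.graph.TpH := by
  rw [cor23v_iff_graph]
  constructor
  · intro h
    ext t
    rw [Subgroup.mem_comap]
    constructor
    · intro ht
      have hmem : D.graph.ι t ∈ (D.graph.HatH : Set D.graph.Hat) ∩ Set.range D.graph.ι := ⟨ht, ⟨t, rfl⟩⟩
      rw [h] at hmem
      obtain ⟨s, hs, hst⟩ := hmem
      rw [← D.graph.ι_injective hst]
      exact hs
    · intro ht
      exact D.graph.tpH_le ⟨t, ht, rfl⟩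
  · intro h
    apply Set.Subset.antisymm
    · rintro _ ⟨hyH, ⟨t, rfl⟩⟩
      have ht : t ∈ D.graph.HatH.comap D.graph.ι := hyH
      rw [h] at ht
      exact ⟨t, ht, rfl⟩
    · rintro _ ⟨t, ht, rfl⟩
      exact ⟨D.graph.tpH_le ⟨t, ht, rfl⟩, ⟨t, rfl⟩⟩

/-- Cor. 2.3 (v) from `ι⁻¹(Π̂_ℍ) ≤ Π^tp_ℍ` (the reverse inclusion is the datum's `Π^tp_ℍ ↪ Π̂_ℍ`).
[cite: Mochizuki2012, Cor 2.3(v) p.48] -/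
theorem cor23v_of_comap_le (hv : D.graph.HatH.comap D.graph.ι ≤ D.graph.TpH) : D.Cor23v :=
  D.cor23v_iff_comap.2 (le_antisymm hv fun t ht => D.graph.tpH_le ⟨t, ht, rfl⟩)

end Abstract

/-! ### C. At the genuine 𝔛-datum `ofSpecialFibre` -/

section Genuine

variable {p : ℕ} [Fact p.Prime] (X : TemperedCurve p) (d : X.GroupLevelData)
  (S : SpecialFibreData (X.toTemperedArithmeticGroup d)) (h36 : S.Gc.Prop36Hypotheses)
  (Sigma SigmaHat : Set ℕ) (hsub : Sigma ⊆ SigmaHat) (hne : Sigma.Nonempty)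
  (hprime : ∀ q ∈ SigmaHat, q.Prime) (hp : p ∉ Sigma)
  (TpH : Subgroup S.chart.G)
  (HatH : Subgroup (TemperedGraphGroupData.exists_completion_of_prop36 S.Gc h36 S.chart).choose)
  (hle : TpH.map (TemperedGraphGroupData.exists_completion_of_prop36 S.Gc h36
    S.chart).choose_spec.choose.toMonoidHom ≤ HatH)
  (cuspMeetsH : {x : X.Pt // X.IsCusp x} → Prop)

/-- **Row `IUTchI:Cor2.3(i)` at the genuine datum, TIGHT**: Cor. 2.3 (i) AS TYPED for `𝔇 = ofSpecialFibre …` with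
parameters `Π^tp_ℍ := TpH`, `Π̂_ℍ := HatH` is EQUIVALENT to "`TpH` is commensurably terminal in `π₁^temp(G^c)`
and `HatH` in `Π̂_𝔾`". [cite: Mochizuki2012, Cor 2.3(i) pp.47-48] -/
theorem cor23i_ofSpecialFibre_iff :
    (ofSpecialFibre X d S h36 Sigma SigmaHat hsub hne hprime hp TpH HatH hle cuspMeetsH).Cor23i ↔
      IsCommensurablyTerminal TpH ∧ IsCommensurablyTerminal HatH :=
  (ofSpecialFibre X d S h36 Sigma SigmaHat hsub hne hprime hp TpH HatH hle cuspMeetsH).cor23i_iff_graph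

/-- **Row `IUTchI:Cor2.3(i)` at the genuine datum BY NAME from `{htp, hhat}` only** (no tower, no `hHstab`, no
KER-LEVEL): the two consumed clauses of Prop. 2.2 for the special-fibre 𝔾-data.
[cite: Mochizuki2012, Cor 2.3(i) p.48] -/
theorem cor23i_ofSpecialFibre_of_commTerminal (htp : IsCommensurablyTerminal TpH)
    (hhat : IsCommensurablyTerminal HatH) :
    (ofSpecialFibre X d S h36 Sigma SigmaHat hsub hne hprime hp TpH HatH hle cuspMeetsH).Cor23i :=
  (ofSpecialFibre X d S h36 Sigma SigmaHat hsub hne hprime hp TpH HatH hle cuspMeetsH).cor23i_of_commTerminal htp hhat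

/-- **Row `IUTchI:Cor2.3(v)` at the genuine datum, TIGHT**: Cor. 2.3 (v) AS TYPED for `𝔇` is EQUIVALENT to
`ι⁻¹(HatH) = TpH` in `π₁^temp(G^c)`. [cite: Mochizuki2012, Cor 2.3(v) pp.48-50] -/
theorem cor23v_ofSpecialFibre_iff :
    (ofSpecialFibre X d S h36 Sigma SigmaHat hsub hne hprime hp TpH HatH hle cuspMeetsH).Cor23v ↔
      HatH.comap (TemperedGraphGroupData.exists_completion_of_prop36 S.Gc h36
        S.chart).choose_spec.choose.toMonoidHom = TpH :=
  (ofSpecialFibre X d S h36 Sigma SigmaHat hsub hne hprime hp TpH HatH hle cuspMeetsH).cor23v_iff_comap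

end Genuine

/-! ### D. Print's parameter `Π̂_ℍ :=` the closure of `Π^tp_ℍ` in `Π̂_𝔾` -/

section Closure

variable {p : ℕ} [Fact p.Prime] (X : TemperedCurve p) (d : X.GroupLevelData)
  (S : SpecialFibreData (X.toTemperedArithmeticGroup d)) (h36 : S.Gc.Prop36Hypotheses)
  (Sigma SigmaHat : Set ℕ) (hsub : Sigma ⊆ SigmaHat) (hne : Sigma.Nonempty)
  (hprime : ∀ q ∈ SigmaHat, q.Prime) (hp : p ∉ Sigma)
  (TpH : Subgroup S.chart.G)
  (cuspMeetsH : {x : X.Pt // X.IsCusp x} → Prop)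

/-- **Row `IUTchI:Cor2.3(v)` at the genuine datum with print's `Π̂_ℍ`, TIGHT**: Cor. 2.3 (v) AS TYPED ⇔ `Π^tp_ℍ` is
the full preimage of its own closure, `ι⁻¹(closure ι(Π^tp_ℍ)) = Π^tp_ℍ` — "`Π^tp_ℍ` is closed for the profinite
topology of `π₁^temp(G^c)`" (print's "`F̂ ⋂ G = F`", p. 50 l. 1). [cite: Mochizuki2012, Cor 2.3(v) pp.48-50] -/
theorem cor23v_ofSpecialFibre_closureH_iff :
    (ofSpecialFibre X d S h36 Sigma SigmaHat hsub hne hprime hp TpH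
      ((TpH.map (TemperedGraphGroupData.exists_completion_of_prop36 S.Gc h36
        S.chart).choose_spec.choose.toMonoidHom).topologicalClosure) (Subgroup.le_topologicalClosure _) cuspMeetsH).Cor23v ↔
      ((TpH.map (TemperedGraphGroupData.exists_completion_of_prop36 S.Gc h36 S.chart).choose_spec.choose.toMonoidHom).topologicalClosure).comap
          (TemperedGraphGroupData.exists_completion_of_prop36 S.Gc h36 S.chart).choose_spec.choose.toMonoidHom =
        TpH :=
  (ofSpecialFibre X d S h36 Sigma SigmaHat hsub hne hprime hp TpH
      ((TpH.map (TemperedGraphGroupData.exists_completion_of_prop36 S.Gc h36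
        S.chart).choose_spec.choose.toMonoidHom).topologicalClosure) (Subgroup.le_topologicalClosure _) cuspMeetsH).cor23v_iff_comap

/-- **Row `IUTchI:Cor2.3(v)` BY NAME at print's parameter from profinite-closedness of `Π^tp_ℍ`**
(`ι⁻¹(closure ι(Π^tp_ℍ)) ≤ Π^tp_ℍ`). [cite: Mochizuki2012, Cor 2.3(v) p.48] -/
theorem cor23v_ofSpecialFibre_closureH_of_closed
    (hcl : ((TpH.map (TemperedGraphGroupData.exists_completion_of_prop36 S.Gc h36 S.chart).choose_spec.choose.toMonoidHom).topologicalClosure).comap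
        (TemperedGraphGroupData.exists_completion_of_prop36 S.Gc h36 S.chart).choose_spec.choose.toMonoidHom ≤
      TpH) :
    (ofSpecialFibre X d S h36 Sigma SigmaHat hsub hne hprime hp TpH
      ((TpH.map (TemperedGraphGroupData.exists_completion_of_prop36 S.Gc h36
        S.chart).choose_spec.choose.toMonoidHom).topologicalClosure) (Subgroup.le_topologicalClosure _) cuspMeetsH).Cor23v :=
  (ofSpecialFibre X d S h36 Sigma SigmaHat hsub hne hprime hp TpH
      ((TpH.map (TemperedGraphGroupData.exists_completion_of_prop36 S.Gc h36
        S.chart).choose_spec.choose.toMonoidHom).topologicalClosure) (Subgroup.le_topologicalClosure _) cuspMeetsH).cor23v_of_comap_le hcl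

/-- **Row `IUTchI:Cor2.3(i)` at print's parameter, TIGHT**: Cor. 2.3 (i) AS TYPED ⇔ `C(Π^tp_ℍ) = Π^tp_ℍ` in
`π₁^temp(G^c)` and `C(closure ι(Π^tp_ℍ)) = closure ι(Π^tp_ℍ)` in `Π̂_𝔾`. [cite: Mochizuki2012, Cor 2.3(i) pp.47-48] -/
theorem cor23i_ofSpecialFibre_closureH_iff :
    (ofSpecialFibre X d S h36 Sigma SigmaHat hsub hne hprime hp TpH
      ((TpH.map (TemperedGraphGroupData.exists_completion_of_prop36 S.Gc h36
        S.chart).choose_spec.choose.toMonoidHom).topologicalClosure) (Subgroup.le_topologicalClosure _) cuspMeetsH).Cor23i ↔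
      IsCommensurablyTerminal TpH ∧
        IsCommensurablyTerminal ((TpH.map (TemperedGraphGroupData.exists_completion_of_prop36 S.Gc h36 S.chart).choose_spec.choose.toMonoidHom).topologicalClosure) :=
  (ofSpecialFibre X d S h36 Sigma SigmaHat hsub hne hprime hp TpH
      ((TpH.map (TemperedGraphGroupData.exists_completion_of_prop36 S.Gc h36
        S.chart).choose_spec.choose.toMonoidHom).topologicalClosure) (Subgroup.le_topologicalClosure _) cuspMeetsH).cor23i_iff_graph

end Closure

end StableCurveTemperedData

end Literature.IUT.HodgeTheaters

end
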